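import Summits.KontsevichZagierPeriods.Zeta5Search.LaiSweepShard

/-!
# `κ₃` sweep certificate — shard file 041 of 127 (shards 287–293 of 889)

HONEST FRAMING. Systematic search; no irrationality claim unless certified. This file only checks,
by `decide +kernel`, shards 287–293 of the order-cell sweep of the `κ₃` point `(74, 2180, 444; δ74)`
(engine `LaiSweepEngine`, soundness `LaiSweepJump/Free/Eval/Shard/Kappa3`; a shard is `⟨regime, n,
p, q, p', q', Lo, Up⟩`: `n` cells from `p/q` to `p'/q'` with integer rate sums in `[Lo, Up]`, `K =
128`, `D = 2^40`). It draws NO conclusion: only the capstone `LaiKappa3SweepCert`, which needs all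
127 shard files, does. Kernel cost of this file ≈ 560 cells × 0.3 s.
-/

namespace Summit.KontsevichZagierPeriods.Zeta5Search.Sweep

set_option maxHeartbeats 100000000 in
/-- Shard 287: 80 cells of regime B from `69/284` to `53/217`.
[cite: Lai2024BallRivoal, §4 Lemma 4.3] -/
theorem shard287 :
    Shard.check 128 (2^40)
      ⟨true, 80, 69, 284, 53, 217, 27801405035700, 29039340620025⟩ = true := by
  decide +kernel

set_option maxHeartbeats 100000000 in
/-- Shard 288: 80 cells of regime B from `53/217` to `95/387`.
[cite: Lai2024BallRivoal, §4 Lemma 4.3] -/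
theorem shard288 :
    Shard.check 128 (2^40)
      ⟨true, 80, 53, 217, 95, 387, 26714492237618, 27917942884940⟩ = true := by
  decide +kernel

set_option maxHeartbeats 100000000 in
/-- Shard 289: 80 cells of regime B from `95/387` to `75/304`.
[cite: Lai2024BallRivoal, §4 Lemma 4.3] -/
theorem shard289 :
    Shard.check 128 (2^40)
      ⟨true, 80, 95, 387, 75, 304, 26303657636256, 27502043391448⟩ = true := by
  decide +kernel

set_option maxHeartbeats 100000000 in
/-- Shard 290: 80 cells of regime B from `75/304` to `91/367`.
[cite: Lai2024BallRivoal, §4 Lemma 4.3] -/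
theorem shard290 :
    Shard.check 128 (2^40)
      ⟨true, 80, 75, 304, 91, 367, 26655481607297, 27883791514425⟩ = true := by
  decide +kernel

set_option maxHeartbeats 100000000 in
/-- Shard 291: 80 cells of regime B from `91/367` to `68/273`.
[cite: Lai2024BallRivoal, §4 Lemma 4.3] -/
theorem shard291 :
    Shard.check 128 (2^40)
      ⟨true, 80, 91, 367, 68, 273, 23855194013965, 24966167142829⟩ = true := by
  decide +kernel

set_option maxHeartbeats 100000000 in
/-- Shard 292: 80 cells of regime B from `68/273` to `80/319`.
[cite: Lai2024BallRivoal, §4 Lemma 4.3] -/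
theorem shard292 :
    Shard.check 128 (2^40)
      ⟨true, 80, 68, 273, 80, 319, 35696708528296, 37396505956448⟩ = true := by
  decide +kernel

set_option maxHeartbeats 100000000 in
/-- Shard 293: 80 cells of regime B from `80/319` to `605/2402`.
[cite: Lai2024BallRivoal, §4 Lemma 4.3] -/
theorem shard293 :
    Shard.check 128 (2^40)
      ⟨true, 80, 80, 319, 605, 2402, 22968926390755, 24066442354942⟩ = true := by
  decide +kernel

/-- The checked shards of this file, in order. [folklore] -/
def shards041 : List (CheckedShard 128 (2^40)) :=
  [⟨_, shard287⟩, ⟨_, shard288⟩, ⟨_, shard289⟩, ⟨_, shard290⟩, ⟨_, shard291⟩,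
    ⟨_, shard292⟩, ⟨_, shard293⟩]

end Summit.KontsevichZagierPeriods.Zeta5Search.Sweep
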